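import Summits.Ventures.PercRepro.RankLevelSetBoolInOutFree

/-! # RankLevelSetBoolUpFree — THE CELL'S (UP) HOLDS FOR EVERY FREE AND EVERY UNIFORM MATROID (night-1 g33;
dossier §45.8 (d))

The cell's conjecture (UP) (`RankLevelSetBiIndepUpSet`, dossier §44.3) asks `NormSkew (upCount M U) #E` for every
family `U` up-closed among the flats of `M`, `upCount M U k = #{W ∈ D_k : cl W ∈ U}`. For the FREE matroid it is the
local LYM inequality of an up-set of `2^[n]`: the boundary double counting of `RankLevelSetBoolInOut`
(`card_bdryPairs_add`, valid for every up-set) gives `(n − k) · u_k ≤ (k + 1) · u_{k+1}`, i.e. the density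
`u_k / C(n, k)` is nondecreasing (**`normSkew_levelCount_of_isUpperSet`**), and the transfer of
`RankLevelSetBoolInOutFree` carries it to `BiIndepUpNormSkew (freeOn E)` (**`biIndepUpNormSkew_freeOn`**). (UP)
survives truncation with NO bottom condition — the window of a `NormSkew (·; #E)` sequence is again one
(**`SkewConv.normSkew_window'`**, **`biIndepUpNormSkew_truncateTo`**) — so **`biIndepUpNormSkew_truncateTo_freeOn`**:
(UP) for every uniform matroid with an arbitrary filter of flats; by g32's `biIndepMono_of_upNormSkew` this
re-derives Mono for uniform matroids. Every declaration has a docstring; imports: the cell's own modules and Mathlib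
only. Axioms: standard. -/

namespace PercRepro

namespace SkewConv

/-- The chain of consecutive steps with no range restriction: if `v k · C(N, k+1) ≤ v (k+1) · C(N, k)` for every
`k < N`, then `v i · C(N, j) ≤ v j · C(N, i)` for all `i ≤ j ≤ N`. -/
lemma chain_of_step_all {v : ℕ → ℕ} {N : ℕ}
    (hstep : ∀ k, k < N → v k * N.choose (k + 1) ≤ v (k + 1) * N.choose k) (i : ℕ) :
    ∀ d, i + d ≤ N → v i * N.choose (i + d) ≤ v (i + d) * N.choose i := by
  intro d
  induction d with
  | zero => intro _; simp
  | succ d ih =>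
    intro hd
    have h1 := ih (by omega)
    have h2 := hstep (i + d) (by omega)
    have hpos : 0 < N.choose (i + d) := Nat.choose_pos (by omega)
    rw [← Nat.add_assoc]
    refine Nat.le_of_mul_le_mul_right (c := N.choose (i + d)) ?_ hpos
    calc v i * N.choose (i + d + 1) * N.choose (i + d) = (v i * N.choose (i + d)) * N.choose (i + d + 1) := by ring
      _ ≤ (v (i + d) * N.choose i) * N.choose (i + d + 1) := Nat.mul_le_mul_right _ h1
      _ = N.choose i * (v (i + d) * N.choose (i + d + 1)) := by ring
      _ ≤ N.choose i * (v (i + d + 1) * N.choose (i + d)) := Nat.mul_le_mul_left _ h2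
      _ = v (i + d + 1) * N.choose i * N.choose (i + d) := by ring

/-- **`NormSkew` from a nondecreasing density**: steps for every `k < N` give `NormSkew v N`. -/
theorem normSkew_of_step_all {v : ℕ → ℕ} {N : ℕ}
    (hstep : ∀ k, k < N → v k * N.choose (k + 1) ≤ v (k + 1) * N.choose k) : NormSkew v N := by
  intro i j hij hR
  have := chain_of_step_all hstep i (j - i) (by omega)
  rwa [Nat.add_sub_cancel' hij.le] at this

/-- **A window keeps `NormSkew (·; n)`** (no bottom condition: `j ≤ n − i ≤ k` for every compared `j`). -/
lemma normSkew_window' {a : ℕ → ℕ} {n k : ℕ} (h : NormSkew a n) : NormSkew (window a n k) n := by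
  intro i j hij hR
  unfold window
  by_cases hi : i ≤ k ∧ n - i ≤ k
  · rw [if_pos hi]
    have hj : j ≤ k ∧ n - j ≤ k := ⟨by omega, by omega⟩
    rw [if_pos hj]
    exact h i j hij hR
  · rw [if_neg hi]; simp

end SkewConv

open Finset

namespace Cycle

variable {α : Type} [Fintype α] [DecidableEq α]

/-- **THE BOOLEAN (UP)**: the level profile of an up-set `U ⊆ 2^α` satisfies `NormSkew (levelCount U) #α`
(local LYM: the density `u_k / C(n, k)` is nondecreasing, from the boundary double counting). -/
theorem normSkew_levelCount_of_isUpperSet {n : ℕ} (hn : Fintype.card α = n) {U : Finset (Finset α)}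
    (hup : IsUpperSet (U : Set (Finset α))) : SkewConv.NormSkew (levelCount U) n := by
  apply SkewConv.normSkew_of_step_all
  intro k hk
  have h2 := card_bdryPairs_add hn hup k
  have hstep : (n - k) * levelCount U k ≤ (k + 1) * levelCount U (k + 1) := by omega
  have hch := Nat.choose_succ_right_eq n k
  refine Nat.le_of_mul_le_mul_right (c := k + 1) ?_ (Nat.succ_pos k)
  calc levelCount U k * n.choose (k + 1) * (k + 1) = levelCount U k * (n.choose (k + 1) * (k + 1)) := by ring
    _ = levelCount U k * (n.choose k * (n - k)) := by rw [hch]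
    _ = ((n - k) * levelCount U k) * n.choose k := by ring
    _ ≤ ((k + 1) * levelCount U (k + 1)) * n.choose k := Nat.mul_le_mul_right _ hstep
    _ = levelCount U (k + 1) * n.choose k * (k + 1) := by ring

end Cycle

open Set

variable {α : Type}

/-- The up-set `k`-sets of `(freeOn E, U)`: the `k`-subsets `W ⊆ E` with `W ∈ U`. -/
lemma upCount_freeOn (E : Set α) (U : Set (Set α)) (k : ℕ) :
    upCount (Matroid.freeOn E) U k = {W : Set α | W ⊆ E ∧ W.ncard = k ∧ W ∈ U}.ncard := by
  unfold upCount biIndep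
  congr 1
  ext W
  simp only [Set.mem_setOf_eq, Matroid.freeOn_ground, Matroid.freeOn_indep_iff, Matroid.freeOn_closure_eq]
  constructor
  · rintro ⟨⟨hWE, hk, -, -⟩, hin⟩
    rw [Set.inter_eq_left.mpr hWE] at hin
    exact ⟨hWE, hk, hin⟩
  · rintro ⟨hWE, hk, hin⟩
    exact ⟨⟨hWE, hk, hWE, Set.sdiff_subset⟩, by rwa [Set.inter_eq_left.mpr hWE]⟩

open Classical in
/-- **The up-set family of the free matroid, on the subtype `↥E`**: `W'` with `val '' W' ∈ U`. -/
noncomputable def freeUp (E : Set α) [Fintype E] (U : Set (Set α)) : Finset (Finset E) :=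
  Finset.univ.filter (fun W' : Finset E => (Subtype.val '' (W' : Set E)) ∈ U)

/-- Membership in the up-set family. -/
lemma mem_freeUp {E : Set α} [Fintype E] {U : Set (Set α)} {W' : Finset E} :
    W' ∈ freeUp E U ↔ (Subtype.val '' (W' : Set E)) ∈ U := by
  simp [freeUp]

/-- The up-set family is an up-set (for `U` up-closed among the flats of `freeOn E`). -/
lemma isUpperSet_freeUp (E : Set α) [Fintype E] {U : Set (Set α)} (hU : UpSetFlats (Matroid.freeOn E) U) :
    IsUpperSet ((freeUp E U : Finset (Finset E)) : Set (Finset E)) := by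
  intro W₁ W₂ hle h
  rw [Finset.mem_coe, mem_freeUp] at h ⊢
  exact hU _ h _ ((freeOn_isFlat_iff E _).mpr (image_val_subset W₂)) (Set.image_mono (Finset.coe_subset.mpr hle))

/-- **The `k`-members of the up-set family are the up-set `k`-sets of `(freeOn E, U)`**:
`upCount (freeOn E) U k = levelCount (freeUp E U) k`. -/
lemma upCount_freeOn_eq_levelCount (E : Set α) [Fintype E] [DecidableEq α] (U : Set (Set α)) (k : ℕ) :
    upCount (Matroid.freeOn E) U k = Cycle.levelCount (freeUp E U) k := by
  classical
  have himage : ∀ {W : Set α} (hWE : W ⊆ E) (hWfin : W.Finite),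
      Subtype.val '' ((hWfin.toFinset.subtype (· ∈ E) : Finset E) : Set E) = W := by
    intro W hWE hWfin
    ext x
    simp only [Set.mem_image, Finset.mem_coe, Finset.mem_subtype, Set.Finite.mem_toFinset]
    constructor
    · rintro ⟨y, hy, rfl⟩; exact hy
    · intro hx; exact ⟨⟨x, hWE hx⟩, hx, rfl⟩
  rw [upCount_freeOn, Cycle.levelCount]
  have hinj : Function.Injective (fun W' : Finset E => Subtype.val '' (W' : Set E)) := by
    intro W₁ W₂ h
    exact Finset.coe_injective (Set.image_injective.mpr Subtype.val_injective h)
  have heq : {W : Set α | W ⊆ E ∧ W.ncard = k ∧ W ∈ U} =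
      (fun W' : Finset E => Subtype.val '' (W' : Set E)) '' (((freeUp E U).filter (fun W' => W'.card = k) :
        Finset (Finset E)) : Set (Finset E)) := by
    ext W
    constructor
    · rintro ⟨hWE, hk, hin⟩
      have hWfin : W.Finite := (Set.toFinite E).subset hWE
      refine ⟨hWfin.toFinset.subtype (· ∈ E), ?_, himage hWE hWfin⟩
      rw [Finset.mem_coe, Finset.mem_filter, mem_freeUp]
      refine ⟨?_, ?_⟩
      · rw [himage hWE hWfin]; exact hin
      · rw [Finset.card_subtype, Finset.filter_true_of_mem (fun x hx => hWE (hWfin.mem_toFinset.mp hx)),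
          ← Set.ncard_eq_toFinset_card W hWfin, hk]
    · rintro ⟨W', hW', rfl⟩
      rw [Finset.mem_coe, Finset.mem_filter, mem_freeUp] at hW'
      obtain ⟨hin, hk⟩ := hW'
      refine ⟨image_val_subset W', ?_, hin⟩
      rw [Set.ncard_image_of_injective _ Subtype.val_injective, Set.ncard_coe_finset, hk]
  rw [heq, Set.ncard_image_of_injective _ hinj, Set.ncard_coe_finset]

/-- **THE CELL'S (UP) FOR EVERY FREE MATROID**: `BiIndepUpNormSkew (freeOn E)` for finite `E`. -/
theorem biIndepUpNormSkew_freeOn {E : Set α} (hE : E.Finite) : BiIndepUpNormSkew (Matroid.freeOn E) := by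
  classical
  haveI : Fintype E := hE.fintype
  intro U hU
  rw [Matroid.freeOn_ground]
  have hn : Fintype.card E = E.ncard := by
    rw [Set.ncard_eq_toFinset_card' E, Set.toFinset_card]
  have := Cycle.normSkew_levelCount_of_isUpperSet hn (isUpperSet_freeUp E hU)
  exact SkewConv.normSkew_congr this fun k _ => (upCount_freeOn_eq_levelCount E U k).symm

variable (M : Matroid α) [M.Finite]

/-- **The up-set profile of the truncation is the window of the lifted profile.** -/
theorem upCount_truncateTo (k : ℕ) (U : Set (Set α)) (j : ℕ) :
    upCount (truncateTo M k) U j = SkewConv.window (upCount M (liftCut M k U)) M.E.ncard k j := by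
  unfold upCount SkewConv.window
  rw [biIndep_truncateTo]
  split_ifs with hw
  · congr 1
    ext W
    simp only [Set.mem_setOf_eq, closure_mem_liftCut_iff]
  · simp

/-- **(UP) SURVIVES TRUNCATION**: `BiIndepUpNormSkew M → BiIndepUpNormSkew (truncateTo M k)`. -/
theorem biIndepUpNormSkew_truncateTo (h : BiIndepUpNormSkew M) (k : ℕ) :
    BiIndepUpNormSkew (truncateTo M k) := by
  intro U hU
  rw [truncateTo_E]
  have hlift := h (liftCut M k U) (upSetFlats_liftCut M hU)
  exact SkewConv.normSkew_congr (SkewConv.normSkew_window' hlift) fun j _ => (upCount_truncateTo M k U j).symm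

/-- **THE CELL'S (UP) FOR EVERY UNIFORM MATROID**: every truncation of a free matroid on a finite set satisfies
`BiIndepUpNormSkew`. -/
theorem biIndepUpNormSkew_truncateTo_freeOn {E : Set α} (hE : E.Finite) (r : ℕ) :
    haveI : (Matroid.freeOn E).Finite := ⟨hE⟩
    BiIndepUpNormSkew (truncateTo (Matroid.freeOn E) r) := by
  haveI : (Matroid.freeOn E).Finite := ⟨hE⟩
  exact biIndepUpNormSkew_truncateTo (Matroid.freeOn E) (biIndepUpNormSkew_freeOn hE) r

end PercRepro
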